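import Mathlib
import HarnessLib
import HarnessLib.Audit
import Summits.Langlands.Statement
import Summits.Langlands.Langlands.Theses.CoreAdequacySplit
import Summits.Langlands.Langlands.Theorems.CoreAdequacySplit
import Summits.Langlands.Langlands.Theorems.BrightMateBypass
import Summits.Langlands.Langlands.Theses.LieDefectSplit
import Summits.Langlands.Langlands.Theses.OdlyzkoWorldSplit
import Summits.Langlands.Langlands.Theorems.LieDefectSplit
import Literature.NumberTheory.GaloisRepresentations.ResidualGaloisRep
import Literature.NumberTheory.GaloisRepresentations.AdequateSubgroup
import Literature.NumberTheory.GaloisRepresentations.ExtendedAdequateSubgroup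
import Summits.Langlands.Langlands.Theses.ExtendedAdequacySplit

/-! # birth skeleton (BC3) of CPR = `ExtendedAdequacySplit.CoreIrreducibleProductLifting` (rev 1, VARIANT S: the support CHILD of the split of the
rev-0 residual CORE stmt-Langlands-26842 into [CPR, CORE′], glued by the landed theorem `…ExtAdequacy.Product.core_route_of_product_cells`).
POST-SPLIT form (use THIS file for `crux write <CPR item> Lines/birth.lean` + `skeleton check` once the split has landed): every decl is the route decl BY NAME; concludes `CoreIrreducibleProductLifting_proof`.
CPR = DEG on ℓ ≤ n ∧ ¬SXADQ ∧ CoreIrr ∧ Π: the lifts that become, over some finite solvable Galois E/K, a twisted symmetric square χ ⊗ Sym² σ (n = 3) or a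
tensor product σ₁ ⊗ σ₂ (n = 4) of irreducible geometric rank-2 representations, in the trace currency.  It is NOT attackable outright; its load-bearing stub is
the TRANSPORT T_Π `stub_productDescentTransport : OW → RES → W⁺ → CSD → CPR` (est. M; the print chain Π1–Π6 of the memo §13: ρ|_E irreducible by
¬SolvablyReducible; Serre_w(E) at rank 2 = OW ∧ RES, W⁺ links σ / σᵢ to cuspidal π's of GL₂(𝔸_E); the INDUCTION HYPOTHESIS `LiftBelow n` at m = 2 over E
makes σ, σ₁, σ₂ automorphic; Gelbart–Jacquet Sym² (tree fact `Literature.NumberTheory.Automorphic.GelbartJacquet_symmSq_cuspidal`, non-dihedral proviso from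
irreducibility of Sym² σ = ρ|_E ⊗ χ⁻¹) resp. Ramakrishnan ⊠ (tree fact `Ramakrishnan2000_theoremM`, cuspidality criterion from irreducibility of ρ|_E) give an
automorphic Π_E with matching Satake parameters at unramified places (Chebotarev + `FramedRep.trace`), i.e. ρ|_E automorphic; CSD (Clifford solvable descent
with ϑ = ρ|_E irreducible, m = n) descends to K; LiftTail's local-global compatibility clause rides with CSD's as in T_N).  The other four stubs are the
route's OWN items cited BY NAME (OW stmt-Langlands-28903, RES 28874, W⁺ 17415 — open cruxes of the lineage; CSD 31695 support): CPR closes outright when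
they and T_Π close.  sorries ONLY inside `stub_*`. -/

set_option linter.dupNamespace false

namespace Summit.Langlands.Langlands.Cruxes.CoreIrreducibleProductLifting.Birth

open Filter

open Summit.Langlands.Langlands.Theses.ExtendedAdequacySplit (OdlyzkoWorldAutomorphy TransOdlyzkoAutomorphy SatakeAvatarExistence CliffordSolvableDescent CoreIrreducibleProductLifting)

/-- THE LOAD-BEARING STUB: the product-descent transport T_Π (= rev1.items.json `ProductDescentTransport` with CPR cited by name).  Print chain as in
the module docstring; honest gaps named there (weight bookkeeping of Sym²/⊠ at the archimedean places = LiftTail's regular-algebraic clause for Π_E, read off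
the Hodge–Tate weights of ρ|_E; the identification «trace identity on a solvable E ⟹ ρ|_E ≅ χ ⊗ Sym² σ / σ₁ ⊗ σ₂ as representations» is Brauer–Nesbitt for
the semisimple ρ|_E, irreducible here).  Plausibly TRUE as typed (a conditional); size M. -/
theorem stub_productDescentTransport : OdlyzkoWorldAutomorphy → TransOdlyzkoAutomorphy → SatakeAvatarExistence → CliffordSolvableDescent → CoreIrreducibleProductLifting := by
  sorry

/-- BY-NAME stub: the lineage crux OW `OdlyzkoWorldAutomorphy` (stmt-Langlands-28903; potential automorphy in small residue characteristic). -/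
theorem stub_odlyzkoWorld : OdlyzkoWorldAutomorphy := by
  sorry

/-- BY-NAME stub: the lineage crux RES `TransOdlyzkoAutomorphy` (stmt-Langlands-28874). -/
theorem stub_transOdlyzko : TransOdlyzkoAutomorphy := by
  sorry

/-- BY-NAME stub: the lineage crux W⁺ `SatakeAvatarExistence` (stmt-Langlands-17415; weak ⟹ Satake-matched automorphic avatar). -/
theorem stub_satakeAvatar : SatakeAvatarExistence := by
  sorry

/-- BY-NAME stub: the lineage support CSD `CliffordSolvableDescent` (stmt-Langlands-31695; solvable descent of an irreducible constituent). -/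
theorem stub_cliffordDescent : CliffordSolvableDescent := by
  sorry

/-- The composition: T_Π → OW → RES → W⁺ → CSD → CPR (modus ponens; no other content). -/
theorem CoreIrreducibleProductLifting_of :
    (OdlyzkoWorldAutomorphy → TransOdlyzkoAutomorphy → SatakeAvatarExistence → CliffordSolvableDescent → CoreIrreducibleProductLifting) →
    OdlyzkoWorldAutomorphy → TransOdlyzkoAutomorphy → SatakeAvatarExistence → CliffordSolvableDescent →
    CoreIrreducibleProductLifting :=
  fun hT hO hR hW hD => hT hO hR hW hD

/-- CPR (the ROUTE decl, by name) from its registered stubs. -/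
theorem CoreIrreducibleProductLifting_proof : Summit.Langlands.Langlands.Theses.ExtendedAdequacySplit.CoreIrreducibleProductLifting :=
  CoreIrreducibleProductLifting_of stub_productDescentTransport stub_odlyzkoWorld stub_transOdlyzko stub_satakeAvatar stub_cliffordDescent

end Summit.Langlands.Langlands.Cruxes.CoreIrreducibleProductLifting.Birth
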